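import Literature.Barriers.AnomalousDissipation.ShearFlowViscositySelectionHeat
import Literature.Barriers.AnomalousDissipation.ShearFlowViscositySelectionLemma4TestFields
import Literature.Analysis.FunctionSpaces.TorusSobolevNormProofs
import HarnessLib

/-!
# Bardos–Titi–Wiedemann 2012, Thm. 5 — proof architecture, part 5: uniqueness for the modal
shear-transport equation on `T³` (the mechanism of Lemma 4)

Fifth companion to `Literature/Barriers/AnomalousDissipation/ShearFlowViscositySelection.lean`
(Bardos–Titi–Wiedemann, C. R. Math. 350 (2012), Thm. 5 and Lemma 4). The printed proof of
Thm. 5 identifies the weak-* limit `u₃` of the third components through Lemma 4: "the Cauchy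
problem for the linear transport equation `∂ₜw + v(x₂)∂_{x₁}w = 0`, `w(·,0) = w₀` has a
solution … and this solution is unique in the class `L^∞((0,T);L²(T²))`. We omit the elementary
proof of the Lemma." This file **proves** the uniqueness mechanism in the form in which both
the weak formulation (`Torus.IsWeakScalarTransportOn.ae_mFourierCoeff_eq`,
`FluidPDE/PassiveScalarFourier`) and weak-* limits of the two-and-a-half-dimensional
Navier–Stokes solutions deliver it, on `T³` with the drift `v(x₁)∂₀` (paper coordinates
`x₁, x₂, x₃` ↦ indices `0, 1, 2`):

**`ae_eq_skewTranslate_of_forall_mFourierCoeff_eq`.** Let `v ∈ L²(T)`, `W₀ ∈ L¹(T³)` and let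
`W ∈ L^∞(0,T;L²(T³))` be jointly measurable with, for every `K ∈ ℤ³` and a.e. `t ∈ (0,T)`,
`𝓕(W(t))(K) = 𝓕(W₀)(K) - 2πiK₀ ∫_{(0,t]} 𝓕(v(x₁) W(s))(K) ds`
(the transport equation integrated in time and tested against the characters). Then for a.e.
`t`, `W(t, x) = W₀(x₀ - t v(x₁), x₁, x₂)` for a.e. `x` — the shear transport of `W₀`.

## The (elementary) proof, as formalised

* Slicing `T³ = T_{x₀} × T²_{(x₁,x₂)}` (`measurePreserving_sliceMap`, Mathlib's
  `measurePreserving_piFinSuccAbove`): the Fourier coefficients of `f ∈ L¹(T³)` are the `T²`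
  coefficients of the fibre coefficients `b ↦ ∫ e_{-K₀}(y) f(y,b) dy`
  (`mFourierCoeff_eq_mFourierCoeff_fibreCoeff`, Fubini), so a multiplier relation
  `𝓕f(K) = m(K₀)𝓕g(K)` descends to the fibres for a.e. base point
  (`fibreCoeff_ae_eq_of_forall_mFourierCoeff_eq`, uniqueness of Fourier coefficients in
  `L¹(T²)`, Grafakos 2014, Prop. 3.2.4).
* Time Fubini turns the hypothesis into `𝓕(W(t) - W₀)(K) = -2πiK₀ 𝓕(J_t)(K)` with
  `J_t = ∫₀ᵗ v(x₁)W(s) ds`, whence for a.e. `t`, every `K₀` and a.e. `b ∈ T²` the scalar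
  Volterra equation `P(t,b) = Q(b) - 2πiK₀ v(b₀) ∫₀ᵗ P(s,b) ds` for the fibre coefficients `P`
  of `W` and `Q` of `W₀`.
* Swapping the a.e. quantifiers (`Measure.ae_ae_comm`, on strongly measurable
  representatives), the complex a.e. Volterra lemma
  (`ae_eq_mul_cexp_of_ae_eq_sub_mul_setIntegral`: fundamental theorem of calculus and
  uniqueness for Lipschitz ODEs) gives `P(t,b) = e^{-2πiK₀v(b₀)t} Q(b)`, which is the fibre
  coefficient of the skew translate `W₀(x₀ - tv(x₁), x₁, x₂)` (`fibreCoeff_skew_translate`;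
  the skew translation preserves volume, `measurePreserving_skewTranslate`, Bardos–Titi 2010,
  Lemma 3); uniqueness of Fourier coefficients in `L¹(T³)` concludes.

## Mathlib / tree search

Mathlib (this pin): `MeasurableEquiv.piFinSuccAbove`/`measurePreserving_piFinSuccAbove`,
Fubini (`integral_prod_symm`, `integral_integral_swap`, `Integrable.prod_left_ae`),
`Measure.ae_ae_comm`, `MeasurePreserving.skew_product`, the characters `fourier`,
`UnitAddTorus.mFourier`, ODE uniqueness `ODE_solution_unique_of_mem_Icc_right`; no transport
equation and no partial Fourier transform on tori (searched `transport`, `fibre`/`slice` with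
`mFourierCoeff`: none). Tree: uniqueness of Fourier coefficients in `L¹(T^d)`
(`Torus.ae_eq_of_forall_mFourierCoeff_eq`, `TorusSobolevNormProofs`), the global-volume form of
`mFourierCoeff` (`Torus.mFourierCoeff_eq_integral_volume`), `Torus.fourier_apply_add`
(`TorusAxisAverage`), `memLp_two_uncurry` (`SpaceTimeWeakCompactness`),
`memLp_uncurry_const_eval_one` (`ShearFlowViscositySelectionLimitSteps`).

## References

* C. Bardos, E. S. Titi, E. Wiedemann, C. R. Math. Acad. Sci. Paris 350 (2012) 757–760
  (arXiv:1208.2352), Lemma 4 and the proof of Thm. 5, system (6) (`BardosTitiWiedemann2012`).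
* C. Bardos, E. S. Titi, Discrete Contin. Dyn. Syst. Ser. S 3 (2010) 185–197, Thm. 2 and
  Lemma 3 (the shear flow, Fubini and translation invariance) (`BardosTiti2010`).
* L. Grafakos, *Classical Fourier Analysis*, 3rd ed., GTM 249 (2014), Prop. 3.2.4
  (uniqueness of Fourier coefficients) (`Grafakos2014`).
-/

open MeasureTheory Set Filter Topology Function UnitAddTorus Complex
open scoped ENNReal NNReal InnerProductSpace

noncomputable section

namespace Literature.Barriers.AnomalousDissipation

/-! ## Slicing `T³ = T × T²` along the first coordinate -/

section Slicing

/-- The point of `T³` with first coordinate `y` and remaining coordinates `b ∈ T²`. [folklore] -/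
theorem piFinSuccAbove_symm_apply_eq (p : UnitAddCircle × UnitAddTorus (Fin 2)) :
    (MeasurableEquiv.piFinSuccAbove (fun _ : Fin 3 => UnitAddCircle) 0).symm p =
      (![p.1, p.2 0, p.2 1] : UnitAddTorus (Fin 3)) := by
  ext i
  fin_cases i <;> rfl

/-- **Slicing `T³` along the first coordinate preserves volume**: the map
`(y, b) ↦ (y, b₀, b₁)` from `T × T²` (product of the volumes) to `T³` is measure preserving
(Mathlib's `measurePreserving_piFinSuccAbove`). [folklore] -/
theorem measurePreserving_sliceMap :
    MeasurePreserving (fun p : UnitAddCircle × UnitAddTorus (Fin 2) =>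
        (![p.1, p.2 0, p.2 1] : UnitAddTorus (Fin 3)))
      ((volume : Measure UnitAddCircle).prod (volume : Measure (UnitAddTorus (Fin 2)))) volume := by
  have h := (measurePreserving_piFinSuccAbove (fun _ : Fin 3 => (volume : Measure UnitAddCircle)) 0).symm
  have hfun : (fun p : UnitAddCircle × UnitAddTorus (Fin 2) => (![p.1, p.2 0, p.2 1] : UnitAddTorus (Fin 3))) =
      (MeasurableEquiv.piFinSuccAbove (fun _ : Fin 3 => UnitAddCircle) 0).symm :=
    funext fun p => (piFinSuccAbove_symm_apply_eq p).symm
  rw [hfun]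
  exact h

/-- The slicing map is a measurable embedding (it is a measurable equivalence). [folklore] -/
theorem measurableEmbedding_sliceMap :
    MeasurableEmbedding (fun p : UnitAddCircle × UnitAddTorus (Fin 2) =>
        (![p.1, p.2 0, p.2 1] : UnitAddTorus (Fin 3))) := by
  have hfun : (fun p : UnitAddCircle × UnitAddTorus (Fin 2) => (![p.1, p.2 0, p.2 1] : UnitAddTorus (Fin 3))) =
      (MeasurableEquiv.piFinSuccAbove (fun _ : Fin 3 => UnitAddCircle) 0).symm :=
    funext fun p => (piFinSuccAbove_symm_apply_eq p).symm
  rw [hfun]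
  exact (MeasurableEquiv.piFinSuccAbove (fun _ : Fin 3 => UnitAddCircle) 0).symm.measurableEmbedding

/-- **Integration over `T³` in sliced coordinates**: `∫_{T³} F = ∫_{T×T²} F(y, b₀, b₁)`. [folklore] -/
theorem integral_eq_integral_slice {E : Type*} [NormedAddCommGroup E] [NormedSpace ℝ E]
    (F : UnitAddTorus (Fin 3) → E) :
    ∫ x, F x = ∫ p : UnitAddCircle × UnitAddTorus (Fin 2), F ![p.1, p.2 0, p.2 1] :=
  (measurePreserving_sliceMap.integral_comp measurableEmbedding_sliceMap F).symm

/-- Integrability over `T³` in sliced coordinates. [folklore] -/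
theorem integrable_slice_iff {E : Type*} [NormedAddCommGroup E] {F : UnitAddTorus (Fin 3) → E} :
    Integrable (fun p : UnitAddCircle × UnitAddTorus (Fin 2) => F ![p.1, p.2 0, p.2 1])
        ((volume : Measure UnitAddCircle).prod (volume : Measure (UnitAddTorus (Fin 2)))) ↔
      Integrable F volume :=
  measurePreserving_sliceMap.integrable_comp_emb measurableEmbedding_sliceMap

/-- The characters of `T³` factor along the slicing: `e_K(y, b₀, b₁) = e_{K₀}(y) e_{(K₁,K₂)}(b)`. [folklore] -/
theorem mFourier_slice (K : Fin 3 → ℤ) (y : UnitAddCircle) (b : UnitAddTorus (Fin 2)) :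
    mFourier K (![y, b 0, b 1] : UnitAddTorus (Fin 3)) = fourier (K 0) y * mFourier ![K 1, K 2] b := by
  simp only [mFourier, ContinuousMap.coe_mk, Fin.prod_univ_three, Fin.prod_univ_two,
    Matrix.cons_val_zero, Matrix.cons_val_one, Matrix.cons_val]
  exact mul_assoc _ _ _

/-- Negation of a frequency vector in components. [folklore] -/
theorem neg_vecCons_two (K : Fin 3 → ℤ) : (-![K 1, K 2] : Fin 2 → ℤ) = ![(-K) 1, (-K) 2] := by
  ext j; fin_cases j <;> rfl

/-- The fibre integrand `e_{-K₀}(y) f(y, b)` is integrable on `T × T²` for `f ∈ L¹(T³)`. [folklore] -/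
theorem integrable_fourier_mul_slice {f : UnitAddTorus (Fin 3) → ℂ} (hf : Integrable f volume) (K₀ : ℤ) :
    Integrable (fun p : UnitAddCircle × UnitAddTorus (Fin 2) => fourier (-K₀) p.1 * f ![p.1, p.2 0, p.2 1])
      ((volume : Measure UnitAddCircle).prod (volume : Measure (UnitAddTorus (Fin 2)))) := by
  refine (integrable_slice_iff.2 hf).bdd_mul (c := 1) ?_ (Eventually.of_forall fun p => ?_)
  · exact ((fourier (-K₀)).continuous.comp continuous_fst).aestronglyMeasurable
  · exact (norm_fourier_apply _ _).le

/-- **The fibre coefficients are integrable on the base**: for `f ∈ L¹(T³)` and `K₀ ∈ ℤ`,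
`b ↦ ∫ e_{-K₀}(y) f(y,b) dy ∈ L¹(T²)`. [folklore] -/
theorem integrable_fibreCoeff {f : UnitAddTorus (Fin 3) → ℂ} (hf : Integrable f volume) (K₀ : ℤ) :
    Integrable (fun b : UnitAddTorus (Fin 2) => ∫ y : UnitAddCircle, fourier (-K₀) y * f ![y, b 0, b 1])
      volume :=
  (integrable_fourier_mul_slice hf K₀).integral_prod_right

/-- **Fourier coefficients of `T³` through the fibre coefficients**: for `f ∈ L¹(T³)`,
`𝓕f(K) = 𝓕_{T²}(b ↦ ∫ e_{-K₀}(y) f(y,b) dy)(K₁,K₂)` (Fubini along the slicing). [folklore] -/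
theorem mFourierCoeff_eq_mFourierCoeff_fibreCoeff {f : UnitAddTorus (Fin 3) → ℂ}
    (hf : Integrable f volume) (K : Fin 3 → ℤ) :
    mFourierCoeff f K =
      mFourierCoeff (fun b : UnitAddTorus (Fin 2) => ∫ y : UnitAddCircle, fourier (-(K 0)) y * f ![y, b 0, b 1])
        ![K 1, K 2] := by
  rw [Literature.Analysis.FunctionSpaces.Torus.mFourierCoeff_eq_integral_volume,
    Literature.Analysis.FunctionSpaces.Torus.mFourierCoeff_eq_integral_volume,
    integral_eq_integral_slice]
  have hint : Integrable (fun p : UnitAddCircle × UnitAddTorus (Fin 2) =>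
      mFourier (-K) (![p.1, p.2 0, p.2 1] : UnitAddTorus (Fin 3)) • f ![p.1, p.2 0, p.2 1])
      ((volume : Measure UnitAddCircle).prod (volume : Measure (UnitAddTorus (Fin 2)))) :=
    (integrable_slice_iff.2 hf).bdd_smul 1
      ((mFourier (-K)).continuous.measurable.comp measurableEmbedding_sliceMap.measurable).aestronglyMeasurable
      (Eventually.of_forall fun p => ((mFourier (-K)).norm_coe_le_norm _).trans_eq mFourier_norm)
  rw [Measure.volume_eq_prod, integral_prod_symm _ hint]
  refine integral_congr_ae (Eventually.of_forall fun b => ?_)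
  simp only
  rw [← integral_smul]
  refine integral_congr_ae (Eventually.of_forall fun y => ?_)
  simp only
  rw [mFourier_slice, neg_vecCons_two, smul_eq_mul, smul_eq_mul]
  simp only [Pi.neg_apply]
  ring

/-- Frequencies of `T³` from a first component and a base frequency. [folklore] -/
theorem vecCons_frequency_apply (K₀ : ℤ) (L : Fin 2 → ℤ) :
    (![K₀, L 0, L 1] : Fin 3 → ℤ) 0 = K₀ ∧ (![(![K₀, L 0, L 1] : Fin 3 → ℤ) 1, (![K₀, L 0, L 1] : Fin 3 → ℤ) 2] = L) := by
  refine ⟨rfl, ?_⟩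
  ext j; fin_cases j <;> rfl

/-- **Base uniqueness: a multiplier relation between the Fourier coefficients of two `L¹(T³)`
functions descends to the fibre coefficients.** If `𝓕f(K) = m(K₀) 𝓕g(K)` for all `K ∈ ℤ³`,
then for every `K₀` the fibre coefficients satisfy `∫ e_{-K₀} f(·,b) = m(K₀) ∫ e_{-K₀} g(·,b)`
for a.e. `b ∈ T²` (both sides are `L¹(T²)` functions with the same Fourier coefficients,
`mFourierCoeff_eq_mFourierCoeff_fibreCoeff`; uniqueness of Fourier coefficients in `L¹`,
Grafakos 2014, Prop. 3.2.4, `Torus.ae_eq_of_forall_mFourierCoeff_eq`). [folklore] -/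
theorem fibreCoeff_ae_eq_of_forall_mFourierCoeff_eq {f g : UnitAddTorus (Fin 3) → ℂ}
    (hf : Integrable f volume) (hg : Integrable g volume) (m : ℤ → ℂ)
    (h : ∀ K : Fin 3 → ℤ, mFourierCoeff f K = m (K 0) * mFourierCoeff g K) (K₀ : ℤ) :
    (fun b : UnitAddTorus (Fin 2) => ∫ y : UnitAddCircle, fourier (-K₀) y * f ![y, b 0, b 1]) =ᵐ[volume]
      fun b => m K₀ * ∫ y : UnitAddCircle, fourier (-K₀) y * g ![y, b 0, b 1] := by
  have hF := integrable_fibreCoeff hf K₀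
  have hG := integrable_fibreCoeff hg K₀
  refine Literature.Analysis.FunctionSpaces.Torus.ae_eq_of_forall_mFourierCoeff_eq hF (hG.const_mul _) fun L => ?_
  have e1 := mFourierCoeff_eq_mFourierCoeff_fibreCoeff hf ![K₀, L 0, L 1]
  have e2 := mFourierCoeff_eq_mFourierCoeff_fibreCoeff hg ![K₀, L 0, L 1]
  rw [(vecCons_frequency_apply K₀ L).2] at e1 e2
  simp only [Matrix.cons_val_zero] at e1 e2
  have e3 : (fun b : UnitAddTorus (Fin 2) => m K₀ * ∫ y : UnitAddCircle, fourier (-K₀) y * g ![y, b 0, b 1]) =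
      m K₀ • fun b : UnitAddTorus (Fin 2) => ∫ y : UnitAddCircle, fourier (-K₀) y * g ![y, b 0, b 1] := by
    funext b; simp
  rw [e3, Literature.Analysis.FunctionSpaces.Torus.mFourierCoeff_const_smul, smul_eq_mul, ← e2]
  exact e1.symm.trans (h _)

/-- **Fibre coefficients of a skew translate**: translating the first coordinate by an amount
`c(b)` depending on the base point multiplies the fibre coefficient by `e_{-K₀}(c(b))`
(translation invariance of the Haar integral on `T`, and `e_{-K₀}(y + c) = e_{-K₀}(y) e_{-K₀}(c)`). [folklore] -/
theorem fibreCoeff_skew_translate (f : UnitAddTorus (Fin 3) → ℂ) (c : UnitAddTorus (Fin 2) → UnitAddCircle)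
    (K₀ : ℤ) (b : UnitAddTorus (Fin 2)) :
    ∫ y : UnitAddCircle, fourier (-K₀) y * f ![y - c b, b 0, b 1] =
      fourier (-K₀) (c b) * ∫ y : UnitAddCircle, fourier (-K₀) y * f ![y, b 0, b 1] := by
  have h := integral_add_right_eq_self (μ := (volume : Measure UnitAddCircle))
    (fun y => fourier (-K₀) y * f ![y - c b, b 0, b 1]) (c b)
  simp only [add_sub_cancel_right] at h
  rw [← h, ← integral_const_mul]
  refine integral_congr_ae (Eventually.of_forall fun y => ?_)
  simp only
  rw [Literature.Analysis.FunctionSpaces.Torus.fourier_apply_add]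
  ring

/-- **The skew translation `x ↦ (x₀ - c(x₁,x₂), x₁, x₂)` preserves the volume of `T³`**
(in sliced coordinates it is `(y, b) ↦ (y - c(b), b)`, a skew product of translations of `T`;
Bardos–Titi 2010, Lemma 3 for the shear flow). [cite: BardosTiti2010, Lemma 3] -/
theorem measurePreserving_skewTranslate {c : UnitAddTorus (Fin 2) → UnitAddCircle} (hc : Measurable c) :
    MeasurePreserving (fun x : UnitAddTorus (Fin 3) =>
      (![x 0 - c ![x 1, x 2], x 1, x 2] : UnitAddTorus (Fin 3))) volume volume := by
  -- the skew product on `T² × T`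
  have hskew : MeasurePreserving (fun q : UnitAddTorus (Fin 2) × UnitAddCircle => (q.1, q.2 - c q.1))
      ((volume : Measure (UnitAddTorus (Fin 2))).prod (volume : Measure UnitAddCircle))
      ((volume : Measure (UnitAddTorus (Fin 2))).prod (volume : Measure UnitAddCircle)) := by
    refine (MeasurePreserving.id volume).skew_product (g := fun b y => y - c b)
      (measurable_snd.sub (hc.comp measurable_fst)) (Eventually.of_forall fun b => ?_)
    exact (measurePreserving_sub_right volume (c b)).map_eq
  -- the product map `Ψ (y, b) = (y - c b, b)` and the intertwining `Φ ∘ slice = slice ∘ Ψ`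
  have hΨ : MeasurePreserving (fun p : UnitAddCircle × UnitAddTorus (Fin 2) => (p.1 - c p.2, p.2))
      ((volume : Measure UnitAddCircle).prod (volume : Measure (UnitAddTorus (Fin 2))))
      ((volume : Measure UnitAddCircle).prod (volume : Measure (UnitAddTorus (Fin 2)))) := by
    have hswap₁ : MeasurePreserving (Prod.swap : UnitAddCircle × UnitAddTorus (Fin 2) → UnitAddTorus (Fin 2) × UnitAddCircle)
        ((volume : Measure UnitAddCircle).prod volume) ((volume : Measure (UnitAddTorus (Fin 2))).prod volume) :=
      Measure.measurePreserving_swap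
    have hswap₂ : MeasurePreserving (Prod.swap : UnitAddTorus (Fin 2) × UnitAddCircle → UnitAddCircle × UnitAddTorus (Fin 2))
        ((volume : Measure (UnitAddTorus (Fin 2))).prod volume) ((volume : Measure UnitAddCircle).prod volume) :=
      Measure.measurePreserving_swap
    have h := hswap₂.comp (hskew.comp hswap₁)
    exact h
  set Φ : UnitAddTorus (Fin 3) → UnitAddTorus (Fin 3) := fun x => ![x 0 - c ![x 1, x 2], x 1, x 2] with hΦ
  have hproj : Measurable fun x : UnitAddTorus (Fin 3) => (![x 1, x 2] : UnitAddTorus (Fin 2)) :=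
    measurable_pi_lambda _ fun i => by fin_cases i <;> exact measurable_pi_apply _
  have hΦm : Measurable Φ := by
    refine measurable_pi_lambda _ fun i => ?_
    fin_cases i
    · exact (measurable_pi_apply 0).sub (hc.comp hproj)
    · exact measurable_pi_apply 1
    · exact measurable_pi_apply 2
  have hinter : Φ ∘ (fun p : UnitAddCircle × UnitAddTorus (Fin 2) => (![p.1, p.2 0, p.2 1] : UnitAddTorus (Fin 3))) =
      (fun p : UnitAddCircle × UnitAddTorus (Fin 2) => (![p.1, p.2 0, p.2 1] : UnitAddTorus (Fin 3))) ∘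
        fun p : UnitAddCircle × UnitAddTorus (Fin 2) => (p.1 - c p.2, p.2) := by
    funext p
    have hb : (![p.2 0, p.2 1] : UnitAddTorus (Fin 2)) = p.2 := by ext j; fin_cases j <;> rfl
    simp only [Function.comp_apply, hΦ, Matrix.cons_val_zero, Matrix.cons_val_one, Matrix.cons_val, hb]
  refine ⟨hΦm, ?_⟩
  calc Measure.map Φ volume
      = Measure.map Φ (Measure.map (fun p : UnitAddCircle × UnitAddTorus (Fin 2) =>
          (![p.1, p.2 0, p.2 1] : UnitAddTorus (Fin 3))) ((volume : Measure UnitAddCircle).prod volume)) := by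
        rw [measurePreserving_sliceMap.map_eq]
    _ = Measure.map (Φ ∘ fun p : UnitAddCircle × UnitAddTorus (Fin 2) =>
          (![p.1, p.2 0, p.2 1] : UnitAddTorus (Fin 3))) ((volume : Measure UnitAddCircle).prod volume) :=
        Measure.map_map hΦm measurePreserving_sliceMap.measurable
    _ = volume := by rw [hinter]; exact (measurePreserving_sliceMap.comp hΨ).map_eq

end Slicing

/-! ## Complex linear Volterra equations and an a.e. Fubini swap -/

section Volterra

/-- **The integrated linear equation `φ(t) = c - μ ∫₀ᵗ φ` with complex rate has only the
exponential solution** (complex-valued twin of `eq_mul_exp_of_forall_eq_sub_mul_setIntegral`: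
fundamental theorem of calculus for the continuous primitive and uniqueness for Lipschitz
ODEs, Mathlib's `ODE_solution_unique_of_mem_Icc_right`). [folklore] -/
theorem eq_mul_cexp_of_forall_eq_sub_mul_setIntegral {T : ℝ} {c μ : ℂ} {φ : ℝ → ℂ}
    (hφ : IntegrableOn φ (Ioo 0 T))
    (h : ∀ t ∈ Ioc 0 T, φ t = c - μ * ∫ s in Ioc 0 t, φ s) :
    ∀ t ∈ Ioc 0 T, φ t = c * Complex.exp (-(μ * t)) := by
  intro t ht
  have hT : 0 < T := ht.1.trans_le ht.2
  rcases eq_or_ne μ 0 with rfl | hμ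
  · simpa using h t ht
  have hφ' : IntegrableOn φ (Icc 0 T) :=
    (integrableOn_Icc_iff_integrableOn_Ioo (μ := (volume : Measure ℝ))).2 hφ
  set G : ℝ → ℂ := fun τ => ∫ s in (0 : ℝ)..τ, φ s with hG
  have hGc : ContinuousOn G (Icc 0 T) := by
    have := intervalIntegral.continuousOn_primitive_interval (μ := (volume : Measure ℝ))
      (a := 0) (b := T) (f := φ) (by rwa [uIcc_of_le hT.le])
    rwa [uIcc_of_le hT.le] at this
  have hGeq : ∀ τ ∈ Icc 0 T, G τ = ∫ s in Ioc 0 τ, φ s := fun τ hτ =>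
    intervalIntegral.integral_of_le hτ.1
  have hφG : ∀ τ ∈ Ioc 0 T, φ τ = c - μ * G τ := fun τ hτ => by
    rw [hGeq τ ⟨hτ.1.le, hτ.2⟩]; exact h τ hτ
  set g : ℝ → ℂ := fun τ => c - μ * G τ with hg
  have hgc : ContinuousOn g (Icc 0 T) := continuousOn_const.sub (hGc.const_smul μ)
  have hGg : ∀ τ ∈ Icc 0 T, G τ = ∫ s in (0 : ℝ)..τ, g s := by
    intro τ hτ
    rw [hGeq τ hτ, intervalIntegral.integral_of_le hτ.1]
    refine setIntegral_congr_fun measurableSet_Ioc fun s hs => ?_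
    exact hφG s ⟨hs.1, hs.2.trans hτ.2⟩
  have hGderiv : ∀ τ ∈ Ico 0 T, HasDerivWithinAt G (g τ) (Ici τ) τ := by
    intro τ hτ
    have hτ' : τ ∈ Icc 0 T := Ico_subset_Icc_self hτ
    haveI : Fact (τ ∈ Icc 0 T) := ⟨hτ'⟩
    have hint : IntervalIntegrable g volume 0 τ :=
      (hgc.mono (by rw [uIcc_of_le hτ'.1]; exact Icc_subset_Icc le_rfl hτ'.2)).intervalIntegrable
    have h1 : HasDerivWithinAt (fun u => ∫ s in (0 : ℝ)..u, g s) (g τ) (Icc 0 T) τ :=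
      intervalIntegral.integral_hasDerivWithinAt_right hint
        (hgc.stronglyMeasurableAtFilter_nhdsWithin measurableSet_Icc τ) (hgc τ hτ')
    have h2 : HasDerivWithinAt G (g τ) (Icc 0 T) τ :=
      h1.congr (fun y hy => hGg y hy) (hGg τ hτ')
    exact h2.mono_of_mem_nhdsWithin (Icc_mem_nhdsGE_of_mem hτ)
  set Gs : ℝ → ℂ := fun τ => c / μ * (1 - Complex.exp (-(μ * τ))) with hGs
  have hGs_deriv : ∀ τ : ℝ, HasDerivAt Gs (c - μ * Gs τ) τ := by
    intro τ
    have h1 : HasDerivAt (fun τ : ℝ => -(μ * τ)) (-μ) τ := by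
      have e : (fun τ : ℝ => -(μ * τ)) = fun τ : ℝ => -μ * (τ : ℂ) := by funext; ring
      rw [e]
      simpa using (Complex.ofRealCLM.hasDerivAt (x := τ)).const_mul (-μ)
    have h2 : HasDerivAt (fun τ : ℝ => Complex.exp (-(μ * τ))) (Complex.exp (-(μ * τ)) * -μ) τ :=
      h1.cexp
    have h3 : HasDerivAt Gs (c / μ * (0 - Complex.exp (-(μ * τ)) * -μ)) τ :=
      ((hasDerivAt_const τ (1 : ℂ)).sub h2).const_mul (c / μ)
    convert h3 using 1
    simp only [hGs]
    field_simp
    ring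
  have hv : ∀ τ ∈ Ico (0 : ℝ) T, LipschitzOnWith ‖μ‖₊ ((fun (_ : ℝ) (x : ℂ) => c - μ * x) τ) univ := by
    intro τ _
    refine (LipschitzWith.of_dist_le_mul fun x y => ?_).lipschitzOnWith
    rw [dist_eq_norm, dist_eq_norm, coe_nnnorm]
    have : c - μ * x - (c - μ * y) = -(μ * (x - y)) := by ring
    rw [this, norm_neg, norm_mul]
  have huniq := ODE_solution_unique_of_mem_Icc_right (v := fun (_ : ℝ) (x : ℂ) => c - μ * x)
    (s := fun _ => univ) (K := ‖μ‖₊) (f := G) (g := Gs) (a := 0) (b := T) hv hGc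
    (fun τ hτ => hGderiv τ hτ) (fun _ _ => mem_univ _)
    (fun τ _ => (hGs_deriv τ).continuousAt.continuousWithinAt)
    (fun τ _ => (hGs_deriv τ).hasDerivWithinAt) (fun _ _ => mem_univ _)
    (by simp [hG, hGs])
  have hGt : G t = Gs t := huniq ⟨ht.1.le, ht.2⟩
  rw [hφG t ht, hGt, hGs]
  field_simp
  ring

/-- **A.e. form of the complex Volterra lemma.** If `φ` is integrable on `(0,T)` and
`φ(t) = c - μ ∫_{(0,t]} φ` for a.e. `t ∈ (0,T)`, then `φ(t) = c e^{-μt}` for a.e. `t ∈ (0,T)`: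
the continuous function `g(t) = c - μ∫_{(0,t]} φ` agrees with `φ` a.e., hence satisfies the
equation everywhere on `(0,T]`, and `eq_mul_cexp_of_forall_eq_sub_mul_setIntegral` applies to
it. [folklore] -/
theorem ae_eq_mul_cexp_of_ae_eq_sub_mul_setIntegral {T : ℝ} {c μ : ℂ} {φ : ℝ → ℂ}
    (hφ : IntegrableOn φ (Ioo 0 T))
    (h : ∀ᵐ t ∂(volume.restrict (Ioo 0 T)), φ t = c - μ * ∫ s in Ioc 0 t, φ s) :
    ∀ᵐ t ∂(volume.restrict (Ioo 0 T)), φ t = c * Complex.exp (-(μ * t)) := by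
  set g : ℝ → ℂ := fun t => c - μ * ∫ s in Ioc 0 t, φ s with hg
  -- `g = φ` a.e. on `(0,T)`, so the set integrals of `φ` and `g` over `(0,t]` agree
  have hae : ∀ᵐ t ∂(volume.restrict (Ioo 0 T)), φ t = g t := h
  have hint_eq : ∀ t ∈ Ioc 0 T, ∫ s in Ioc 0 t, φ s = ∫ s in Ioc 0 t, g s := by
    intro t ht
    refine integral_congr_ae ?_
    have h1 : ∀ᵐ s ∂(volume.restrict (Ioo 0 t)), φ s = g s :=
      ae_restrict_of_ae_restrict_of_subset (Ioo_subset_Ioo le_rfl ht.2) hae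
    exact (ae_restrict_congr_set Ioo_ae_eq_Ioc).1 h1
  have hg_int : IntegrableOn g (Ioo 0 T) := hφ.congr_fun_ae hae
  have hg_eq : ∀ t ∈ Ioc 0 T, g t = c - μ * ∫ s in Ioc 0 t, g s := fun t ht => by
    rw [← hint_eq t ht]
  have hsol := eq_mul_cexp_of_forall_eq_sub_mul_setIntegral hg_int hg_eq
  filter_upwards [hae, ae_restrict_mem measurableSet_Ioo] with t ht htI
  rw [ht, hsol t ⟨htI.1, htI.2.le⟩]

/-- **Swapping the order of two "almost everywhere" quantifiers for an equation between a.e.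
strongly measurable functions** on a product of s-finite measure spaces (Fubini–Tonelli for
the null set where the equation fails; Mathlib's `Measure.ae_ae_comm` for the measurable
modifications). [folklore] -/
theorem ae_ae_comm_of_aestronglyMeasurable {α β γ : Type*} [MeasurableSpace α] [MeasurableSpace β]
    {μ : Measure α} {ν : Measure β} [SFinite μ] [SFinite ν]
    [TopologicalSpace γ] [TopologicalSpace.MetrizableSpace γ]
    {F G : α × β → γ} (hF : AEStronglyMeasurable F (μ.prod ν)) (hG : AEStronglyMeasurable G (μ.prod ν))
    (h : ∀ᵐ x ∂μ, ∀ᵐ y ∂ν, F (x, y) = G (x, y)) : ∀ᵐ y ∂ν, ∀ᵐ x ∂μ, F (x, y) = G (x, y) := by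
  borelize γ
  obtain ⟨F', hF'm, hFF'⟩ := hF
  obtain ⟨G', hG'm, hGG'⟩ := hG
  -- transfer to the modifications, along both orders of integration
  have h1 : ∀ᵐ x ∂μ, ∀ᵐ y ∂ν, F (x, y) = F' (x, y) := Measure.ae_ae_of_ae_prod hFF'
  have h2 : ∀ᵐ x ∂μ, ∀ᵐ y ∂ν, G (x, y) = G' (x, y) := Measure.ae_ae_of_ae_prod hGG'
  have hswap : MeasurePreserving (Prod.swap : β × α → α × β) (ν.prod μ) (μ.prod ν) :=
    Measure.measurePreserving_swap
  have h1' : ∀ᵐ y ∂ν, ∀ᵐ x ∂μ, F (x, y) = F' (x, y) :=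
    Measure.ae_ae_of_ae_prod (hswap.quasiMeasurePreserving.ae_eq_comp hFF')
  have h2' : ∀ᵐ y ∂ν, ∀ᵐ x ∂μ, G (x, y) = G' (x, y) :=
    Measure.ae_ae_of_ae_prod (hswap.quasiMeasurePreserving.ae_eq_comp hGG')
  have hmeas : MeasurableSet {p : α × β | F' (p.1, p.2) = G' (p.1, p.2)} :=
    hF'm.measurableSet_eq_fun hG'm
  have h3 : ∀ᵐ x ∂μ, ∀ᵐ y ∂ν, F' (x, y) = G' (x, y) := by
    filter_upwards [h, h1, h2] with x hx hx1 hx2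
    filter_upwards [hx, hx1, hx2] with y hy hy1 hy2
    rw [← hy1, ← hy2, hy]
  have h4 : ∀ᵐ y ∂ν, ∀ᵐ x ∂μ, F' (x, y) = G' (x, y) := (Measure.ae_ae_comm hmeas).1 h3
  filter_upwards [h4, h1', h2'] with y hy hy1 hy2
  filter_upwards [hy, hy1, hy2] with x hx hx1 hx2
  rw [hx1, hx2, hx]

end Volterra

/-! ## Uniqueness for the modal shear-transport equation on `T³` -/

section Core

open Literature.Analysis.FunctionSpaces Literature.Analysis.FunctionSpaces.Torus

/-- Sections of an integrable space–time field along the slicing: for a.e. base point `b ∈ T²`,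
`(t, y) ↦ W(t, (y, b))` is integrable on `(0,T) × T`. [folklore] -/
theorem ae_integrable_section_slice {T : ℝ} {W : ℝ → UnitAddTorus (Fin 3) → ℝ}
    (hW : Integrable (uncurry W) ((volume.restrict (Ioo 0 T)).prod volume)) :
    ∀ᵐ b : UnitAddTorus (Fin 2) ∂volume, Integrable (fun q : ℝ × UnitAddCircle => W q.1 ![q.2, b 0, b 1])
      ((volume.restrict (Ioo 0 T)).prod volume) := by
  -- transport along `id × slice` and reassociate
  have h1 : MeasurePreserving (Prod.map (id : ℝ → ℝ) (fun p : UnitAddCircle × UnitAddTorus (Fin 2) =>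
      (![p.1, p.2 0, p.2 1] : UnitAddTorus (Fin 3))))
      ((volume.restrict (Ioo 0 T)).prod ((volume : Measure UnitAddCircle).prod (volume : Measure (UnitAddTorus (Fin 2)))))
      ((volume.restrict (Ioo 0 T)).prod volume) :=
    (MeasurePreserving.id _).prod measurePreserving_sliceMap
  have h1e : MeasurableEmbedding (Prod.map (id : ℝ → ℝ) (fun p : UnitAddCircle × UnitAddTorus (Fin 2) =>
      (![p.1, p.2 0, p.2 1] : UnitAddTorus (Fin 3)))) :=
    MeasurableEmbedding.id.prodMap measurableEmbedding_sliceMap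
  have h2 := (h1.integrable_comp_emb h1e).2 hW
  have h3 : MeasurePreserving (MeasurableEquiv.prodAssoc : (ℝ × UnitAddCircle) × UnitAddTorus (Fin 2) ≃ᵐ _)
      (((volume.restrict (Ioo 0 T)).prod (volume : Measure UnitAddCircle)).prod (volume : Measure (UnitAddTorus (Fin 2))))
      ((volume.restrict (Ioo 0 T)).prod ((volume : Measure UnitAddCircle).prod (volume : Measure (UnitAddTorus (Fin 2))))) :=
    measurePreserving_prodAssoc _ _ _
  have h4 := (h3.integrable_comp_emb (MeasurableEquiv.prodAssoc).measurableEmbedding).2 h2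
  have h5 := h4.prod_left_ae
  filter_upwards [h5] with b hb
  exact hb

/-- **Uniqueness for the modal shear-transport equation on `T³` (the mechanism of
Bardos–Titi–Wiedemann 2012, Lemma 4), measurable representatives.** Let `v ∈ L²(T)` (strongly
measurable representative), `W₀ ∈ L¹(T³)` (strongly measurable), and let `W : (0,T) × T³ → ℝ` be
jointly strongly measurable, bounded in `L^∞(0,T;L²(T³))`, and satisfy for every frequency
`K ∈ ℤ³` and a.e. `t ∈ (0,T)` the modal integrated transport equation
`𝓕(W(t))(K) = 𝓕(W₀)(K) - 2πiK₀ ∫_{(0,t]} 𝓕(v(x₁) W(s))(K) ds`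
(i.e. `∂ₜW + v(x₁)∂₀W = 0`, `W(0) = W₀`, tested against the characters). Then for a.e.
`t ∈ (0,T)`, `W(t, x) = W₀(x₀ - t v(x₁), x₁, x₂)` for a.e. `x`: slicing `T³ = T_{x₀} × T²`,
base uniqueness (`fibreCoeff_ae_eq_of_forall_mFourierCoeff_eq`) turns the hypothesis into the
scalar Volterra equations `P(t,b) = Q(b) - 2πiK₀ v(b₀) ∫₀ᵗ P(s,b) ds` for the fibre
coefficients, for a.e. base point `b` (Fubini), solved by
`ae_eq_mul_cexp_of_ae_eq_sub_mul_setIntegral`; the solution `e^{-2πiK₀v(b₀)t} Q(b)` is the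
fibre coefficient of the skew translate (`fibreCoeff_skew_translate`), and uniqueness of Fourier
coefficients in `L¹(T³)` concludes. [cite: BardosTitiWiedemann2012, Lemma 4] -/
theorem ae_eq_skewTranslate_of_forall_mFourierCoeff_eq_of_stronglyMeasurable
    {v : UnitAddCircle → ℝ} (hvm : StronglyMeasurable v) (hv : MemLp v 2 volume)
    {W₀ : UnitAddTorus (Fin 3) → ℝ} (hW₀m : StronglyMeasurable W₀) (hW₀ : Integrable W₀ volume)
    {T : ℝ} {W : ℝ → UnitAddTorus (Fin 3) → ℝ}
    (hWsm : StronglyMeasurable (uncurry W))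
    (hWb : ∃ C : ℝ≥0, ∀ᵐ t ∂(volume.restrict (Ioo 0 T)), ∫⁻ x, ‖W t x‖ₑ ^ 2 ≤ C)
    (hmode : ∀ K : Fin 3 → ℤ, ∀ᵐ t ∂(volume.restrict (Ioo 0 T)),
      mFourierCoeff (fun x => (W t x : ℂ)) K = mFourierCoeff (fun x => (W₀ x : ℂ)) K -
        (2 * Real.pi * Complex.I * (K 0)) *
          ∫ s in Ioc 0 t, mFourierCoeff (fun x => ((v (x 1) * W s x : ℝ) : ℂ)) K) :
    ∀ᵐ t ∂(volume.restrict (Ioo 0 T)),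
      W t =ᵐ[volume] fun x => W₀ ![x 0 - (((t * v (x 1) : ℝ)) : UnitAddCircle), x 1, x 2] := by
  set μt : Measure ℝ := volume.restrict (Ioo 0 T) with hμt
  haveI hfinμ : IsFiniteMeasure μt :=
    ⟨by rw [hμt, Measure.restrict_apply_univ]; exact measure_Ioo_lt_top⟩
  obtain ⟨C, hC⟩ := hWb
  /- (0) integrability of `W` and of `v(x₁) W` on `(0,T) × T³` -/
  have hWm : AEStronglyMeasurable (uncurry W) (μt.prod volume) := hWsm.aestronglyMeasurable
  have hfin : ∫⁻ t in Ioo 0 T, ∫⁻ x, ‖W t x‖ₑ ^ 2 < ∞ := by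
    calc ∫⁻ t in Ioo 0 T, ∫⁻ x, ‖W t x‖ₑ ^ 2 ≤ ∫⁻ _ in Ioo 0 T, (C : ℝ≥0∞) := lintegral_mono_ae hC
      _ < ∞ := by
          rw [lintegral_const, Measure.restrict_apply_univ]
          exact ENNReal.mul_lt_top ENNReal.coe_lt_top measure_Ioo_lt_top
  have hW2 : MemLp (uncurry W) 2 (μt.prod volume) := (memLp_two_uncurry hWm hfin).1
  have hWint : Integrable (uncurry W) (μt.prod volume) := hW2.integrable one_le_two
  have hV2 : MemLp (uncurry fun (_ : ℝ) (x : UnitAddTorus (Fin 3)) => v (x 1)) 2 (μt.prod volume) :=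
    memLp_uncurry_const_eval_one hv
  have hVW : Integrable (fun q : ℝ × UnitAddTorus (Fin 3) => v (q.2 1) * W q.1 q.2) (μt.prod volume) :=
    hV2.integrable_mul hW2
  /- (1) all modes at once -/
  have hmode' : ∀ᵐ t ∂μt, ∀ K : Fin 3 → ℤ,
      mFourierCoeff (fun x => (W t x : ℂ)) K = mFourierCoeff (fun x => (W₀ x : ℂ)) K -
        (2 * Real.pi * Complex.I * (K 0)) *
          ∫ s in Ioc 0 t, mFourierCoeff (fun x => ((v (x 1) * W s x : ℝ) : ℂ)) K :=
    ae_all_iff.2 hmode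
  /- (2) the time-integrated flux `J t x = ∫_{(0,t]} v(x₁) W(s,x) ds` and its coefficients -/
  set J : ℝ → UnitAddTorus (Fin 3) → ℝ := fun t x => ∫ s in Ioc 0 t, v (x 1) * W s x with hJ
  have hrestr : ∀ t ∈ Ioo 0 T, (volume.restrict (Ioc 0 t) : Measure ℝ) ≤ μt := by
    intro t ht
    calc (volume.restrict (Ioc 0 t) : Measure ℝ) ≤ volume.restrict (Ioc 0 T) :=
          Measure.restrict_mono (Ioc_subset_Ioc_right ht.2.le) le_rfl
      _ = μt := by rw [hμt]; exact Measure.restrict_congr_set Ioo_ae_eq_Ioc.symm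
  have hVW_t : ∀ t ∈ Ioo 0 T, Integrable (fun q : ℝ × UnitAddTorus (Fin 3) => v (q.2 1) * W q.1 q.2)
      ((volume.restrict (Ioc 0 t)).prod volume) := fun t ht =>
    hVW.mono_measure (Measure.prod_mono (hrestr t ht) le_rfl)
  have hJint : ∀ t ∈ Ioo 0 T, Integrable (J t) volume := fun t ht =>
    (hVW_t t ht).integral_prod_right
  have hJcoeff : ∀ t ∈ Ioo 0 T, ∀ K : Fin 3 → ℤ,
      ∫ s in Ioc 0 t, mFourierCoeff (fun x => ((v (x 1) * W s x : ℝ) : ℂ)) K =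
        mFourierCoeff (fun x => (J t x : ℂ)) K := by
    intro t ht K
    have hI : Integrable (fun q : ℝ × UnitAddTorus (Fin 3) =>
        mFourier (-K) q.2 • (((v (q.2 1) * W q.1 q.2 : ℝ)) : ℂ)) ((volume.restrict (Ioc 0 t)).prod volume) :=
      (ofRealCLM.integrable_comp (hVW_t t ht)).bdd_smul 1
        ((mFourier (-K)).continuous.comp continuous_snd).aestronglyMeasurable
        (Eventually.of_forall fun q => ((mFourier (-K)).norm_coe_le_norm _).trans_eq mFourier_norm)
    have hI' : Integrable (uncurry fun (x : UnitAddTorus (Fin 3)) (s : ℝ) =>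
        mFourier (-K) x • (((v (x 1) * W s x : ℝ)) : ℂ)) (volume.prod (volume.restrict (Ioc 0 t))) :=
      hI.swap
    simp_rw [mFourierCoeff_eq_integral_volume]
    rw [← integral_integral_swap hI']
    refine integral_congr_ae (Eventually.of_forall fun x => ?_)
    simp only [hJ]
    rw [integral_smul, integral_complex_ofReal]
  /- (3) the multiplier relation between `W t - W₀` and `J t` -/
  have hWt_int : ∀ᵐ t ∂μt, Integrable (W t) volume := hWint.prod_right_ae
  have h3 : ∀ᵐ t ∂μt, ∀ K : Fin 3 → ℤ,
      mFourierCoeff (fun x => ((W t x - W₀ x : ℝ) : ℂ)) K =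
        (-(2 * Real.pi * Complex.I * (K 0))) * mFourierCoeff (fun x => (J t x : ℂ)) K := by
    filter_upwards [hmode', hWt_int, ae_restrict_mem measurableSet_Ioo] with t ht hti htI
    intro K
    have e : (fun x => ((W t x - W₀ x : ℝ) : ℂ)) = (fun x => (W t x : ℂ)) - fun x => (W₀ x : ℂ) := by
      funext x; simp
    rw [e, mFourierCoeff_sub hti.ofReal hW₀.ofReal, ht K, ← hJcoeff t htI K]
    ring
  /- (4) base uniqueness: the fibre coefficients, for a.e. base point -/
  have h4 : ∀ᵐ t ∂μt, ∀ K₀ : ℤ,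
      (fun b : UnitAddTorus (Fin 2) => ∫ y : UnitAddCircle,
          fourier (-K₀) y * (((W t ![y, b 0, b 1] - W₀ ![y, b 0, b 1] : ℝ)) : ℂ)) =ᵐ[volume]
        fun b => (-(2 * Real.pi * Complex.I * K₀)) *
          ∫ y : UnitAddCircle, fourier (-K₀) y * ((J t ![y, b 0, b 1] : ℝ) : ℂ) := by
    filter_upwards [h3, hWt_int, ae_restrict_mem measurableSet_Ioo] with t ht hti htI
    intro K₀
    exact fibreCoeff_ae_eq_of_forall_mFourierCoeff_eq (f := fun x => ((W t x - W₀ x : ℝ) : ℂ))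
      (g := fun x => ((J t x : ℝ) : ℂ)) (hti.sub hW₀).ofReal (hJint t htI).ofReal
      (fun K₀ => -(2 * Real.pi * Complex.I * K₀)) (fun K => ht K) K₀
  /- (5) expand both fibre coefficients -/
  -- the fibre coefficients of `W` and of `W₀`
  set P : ℤ → ℝ → UnitAddTorus (Fin 2) → ℂ := fun K₀ t b =>
    ∫ y : UnitAddCircle, fourier (-K₀) y * (W t ![y, b 0, b 1] : ℂ) with hP
  set Q : ℤ → UnitAddTorus (Fin 2) → ℂ := fun K₀ b =>
    ∫ y : UnitAddCircle, fourier (-K₀) y * (W₀ ![y, b 0, b 1] : ℂ) with hQ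
  have hsec := ae_integrable_section_slice hWint
  have hW₀sec : ∀ᵐ b : UnitAddTorus (Fin 2) ∂volume, Integrable (fun y : UnitAddCircle => W₀ ![y, b 0, b 1]) volume :=
    (integrable_slice_iff.2 hW₀).prod_left_ae
  -- (5a) `fibre(W t - W₀) = P t - Q`
  have h5a : ∀ᵐ t ∂μt, ∀ K₀ : ℤ, ∀ᵐ b : UnitAddTorus (Fin 2) ∂volume,
      ∫ y : UnitAddCircle, fourier (-K₀) y * (((W t ![y, b 0, b 1] - W₀ ![y, b 0, b 1] : ℝ)) : ℂ) =
        P K₀ t b - Q K₀ b := by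
    filter_upwards [hWt_int] with t hti
    intro K₀
    filter_upwards [(integrable_slice_iff.2 hti).prod_left_ae, hW₀sec] with b hb hb₀
    simp only [hP, hQ]
    rw [← integral_sub]
    · refine integral_congr_ae (Eventually.of_forall fun y => ?_)
      push_cast
      ring
    · exact hb.ofReal.bdd_mul (c := 1) (fourier (-K₀)).continuous.aestronglyMeasurable
        (Eventually.of_forall fun y => (norm_fourier_apply _ _).le)
    · exact hb₀.ofReal.bdd_mul (c := 1) (fourier (-K₀)).continuous.aestronglyMeasurable
        (Eventually.of_forall fun y => (norm_fourier_apply _ _).le)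
  -- (5b) `fibre(J t)(b) = v(b₀) ∫_{(0,t]} P s b ds`
  have h5b : ∀ᵐ b : UnitAddTorus (Fin 2) ∂volume, ∀ t ∈ Ioo 0 T, ∀ K₀ : ℤ,
      ∫ y : UnitAddCircle, fourier (-K₀) y * ((J t ![y, b 0, b 1] : ℝ) : ℂ) =
        (v (b 0) : ℂ) * ∫ s in Ioc 0 t, P K₀ s b := by
    filter_upwards [hsec] with b hb
    intro t ht K₀
    have hbt : Integrable (fun q : ℝ × UnitAddCircle => W q.1 ![q.2, b 0, b 1])
        ((volume.restrict (Ioc 0 t)).prod volume) :=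
      hb.mono_measure (Measure.prod_mono (hrestr t ht) le_rfl)
    have hI : Integrable (fun q : ℝ × UnitAddCircle =>
        fourier (-K₀) q.2 * (((v (b 0) * W q.1 ![q.2, b 0, b 1] : ℝ)) : ℂ))
        ((volume.restrict (Ioc 0 t)).prod volume) := by
      have h1 : Integrable (fun q : ℝ × UnitAddCircle => (((v (b 0) * W q.1 ![q.2, b 0, b 1] : ℝ)) : ℂ))
          ((volume.restrict (Ioc 0 t)).prod volume) := by
        exact (hbt.const_mul (v (b 0))).ofReal (𝕜 := ℂ)
      exact h1.bdd_mul (c := 1) ((fourier (-K₀)).continuous.comp continuous_snd).aestronglyMeasurable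
        (Eventually.of_forall fun q => (norm_fourier_apply _ _).le)
    have eJ : ∀ y : UnitAddCircle, ((J t ![y, b 0, b 1] : ℝ) : ℂ) =
        ∫ s in Ioc 0 t, (((v (b 0) * W s ![y, b 0, b 1] : ℝ)) : ℂ) := by
      intro y
      simp only [hJ, Matrix.cons_val_one, Matrix.cons_val_zero]
      rw [integral_complex_ofReal]
    have hI' : Integrable (uncurry fun (y : UnitAddCircle) (s : ℝ) =>
        fourier (-K₀) y * (((v (b 0) * W s ![y, b 0, b 1] : ℝ)) : ℂ)) (volume.prod (volume.restrict (Ioc 0 t))) :=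
      hI.swap
    simp_rw [eJ]
    simp_rw [← integral_const_mul]
    rw [integral_integral_swap hI']
    refine integral_congr_ae (Eventually.of_forall fun s => ?_)
    simp only [hP]
    rw [← integral_const_mul]
    refine integral_congr_ae (Eventually.of_forall fun y => ?_)
    push_cast
    ring
  -- (5c) the Volterra relation for a.e. `(t, b)`
  have h5 : ∀ K₀ : ℤ, ∀ᵐ t ∂μt, ∀ᵐ b : UnitAddTorus (Fin 2) ∂volume,
      P K₀ t b = Q K₀ b - (2 * Real.pi * Complex.I * K₀ * v (b 0)) * ∫ s in Ioc 0 t, P K₀ s b := by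
    intro K₀
    filter_upwards [h4, h5a, ae_restrict_mem measurableSet_Ioo] with t h4t h5at htI
    filter_upwards [h4t K₀, h5at K₀, h5b] with b hb hb' hb''
    rw [hb', hb'' t htI K₀] at hb
    linear_combination hb
  /- (6) measurability of the fibre data, and the swap `(t, b) → (b, t)` -/
  have hslice3 : Measurable fun r : (ℝ × UnitAddTorus (Fin 2)) × UnitAddCircle =>
      ((r.1.1, (![r.2, r.1.2 0, r.1.2 1] : UnitAddTorus (Fin 3))) : ℝ × UnitAddTorus (Fin 3)) := by
    refine measurable_fst.fst.prodMk (measurable_pi_lambda _ fun i => ?_)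
    fin_cases i
    · exact measurable_snd
    · exact (measurable_pi_apply 0).comp measurable_fst.snd
    · exact (measurable_pi_apply 1).comp measurable_fst.snd
  have hPsm : ∀ K₀ : ℤ, StronglyMeasurable fun q : ℝ × UnitAddTorus (Fin 2) => P K₀ q.1 q.2 := by
    intro K₀
    have hf : StronglyMeasurable fun r : (ℝ × UnitAddTorus (Fin 2)) × UnitAddCircle =>
        fourier (-K₀) r.2 * (W r.1.1 ![r.2, r.1.2 0, r.1.2 1] : ℂ) :=
      ((fourier (-K₀)).continuous.comp continuous_snd).stronglyMeasurable.mul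
        (Complex.continuous_ofReal.comp_stronglyMeasurable (hWsm.comp_measurable hslice3))
    exact hf.integral_prod_right'
  have hQsm : ∀ K₀ : ℤ, StronglyMeasurable fun b : UnitAddTorus (Fin 2) => Q K₀ b := by
    intro K₀
    have hmap : Measurable fun r : UnitAddTorus (Fin 2) × UnitAddCircle =>
        (![r.2, r.1 0, r.1 1] : UnitAddTorus (Fin 3)) := by
      refine measurable_pi_lambda _ fun i => ?_
      fin_cases i
      · exact measurable_snd
      · exact (measurable_pi_apply 0).comp measurable_fst
      · exact (measurable_pi_apply 1).comp measurable_fst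
    have hf : StronglyMeasurable fun r : UnitAddTorus (Fin 2) × UnitAddCircle =>
        fourier (-K₀) r.2 * (W₀ ![r.2, r.1 0, r.1 1] : ℂ) :=
      ((fourier (-K₀)).continuous.comp continuous_snd).stronglyMeasurable.mul
        (Complex.continuous_ofReal.comp_stronglyMeasurable (hW₀m.comp_measurable hmap))
    exact hf.integral_prod_right'
  have hPrimsm : ∀ K₀ : ℤ, StronglyMeasurable fun q : ℝ × UnitAddTorus (Fin 2) =>
      ∫ s in Ioc 0 q.1, P K₀ s q.2 := by
    intro K₀
    have hset : MeasurableSet {r : (ℝ × UnitAddTorus (Fin 2)) × ℝ | r.2 ∈ Ioc 0 r.1.1} :=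
      (measurableSet_lt measurable_const measurable_snd).inter
        (measurableSet_le measurable_snd measurable_fst.fst)
    have hg : StronglyMeasurable fun r : (ℝ × UnitAddTorus (Fin 2)) × ℝ => P K₀ r.2 r.1.2 :=
      (hPsm K₀).comp_measurable (measurable_snd.prodMk measurable_fst.snd)
    have hind := (hg.indicator hset).integral_prod_right' (ν := (volume : Measure ℝ))
    have e : (fun q : ℝ × UnitAddTorus (Fin 2) => ∫ s in Ioc 0 q.1, P K₀ s q.2) =
        fun q => ∫ y : ℝ, {r : (ℝ × UnitAddTorus (Fin 2)) × ℝ | r.2 ∈ Ioc 0 r.1.1}.indicator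
          (fun r => P K₀ r.2 r.1.2) (q, y) := by
      funext q
      rw [← integral_indicator measurableSet_Ioc]
      rfl
    rw [e]
    exact hind
  have hμsm : StronglyMeasurable fun b : UnitAddTorus (Fin 2) => (2 * Real.pi * Complex.I * (v (b 0) : ℂ)) :=
    stronglyMeasurable_const.mul
      (Complex.continuous_ofReal.comp_stronglyMeasurable (hvm.comp_measurable (measurable_pi_apply 0)))
  have h6 : ∀ K₀ : ℤ, ∀ᵐ b : UnitAddTorus (Fin 2) ∂volume, ∀ᵐ t ∂μt,
      P K₀ t b = Q K₀ b - (2 * Real.pi * Complex.I * K₀ * v (b 0)) * ∫ s in Ioc 0 t, P K₀ s b := by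
    intro K₀
    have hmeas : MeasurableSet {q : ℝ × UnitAddTorus (Fin 2) |
        P K₀ q.1 q.2 = Q K₀ q.2 - (2 * Real.pi * Complex.I * K₀ * v (q.2 0)) * ∫ s in Ioc 0 q.1, P K₀ s q.2} := by
      refine (hPsm K₀).measurableSet_eq_fun ?_
      refine ((hQsm K₀).comp_measurable measurable_snd).sub ?_
      refine StronglyMeasurable.mul ?_ (hPrimsm K₀)
      have : StronglyMeasurable fun q : ℝ × UnitAddTorus (Fin 2) => (K₀ : ℂ) * (2 * Real.pi * Complex.I * (v (q.2 0) : ℂ)) :=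
        stronglyMeasurable_const.mul (hμsm.comp_measurable measurable_snd)
      have e : (fun q : ℝ × UnitAddTorus (Fin 2) => 2 * (Real.pi : ℂ) * Complex.I * K₀ * v (q.2 0)) =
          fun q => (K₀ : ℂ) * (2 * Real.pi * Complex.I * (v (q.2 0) : ℂ)) := funext fun q => by ring
      rw [e]
      exact this
    exact (Measure.ae_ae_comm hmeas).1 (h5 K₀)
  /- (7) the Volterra equation along the fibres, for a.e. base point -/
  have h7 : ∀ K₀ : ℤ, ∀ᵐ b : UnitAddTorus (Fin 2) ∂volume, ∀ᵐ t ∂μt,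
      P K₀ t b = Q K₀ b * Complex.exp (-((2 * Real.pi * Complex.I * K₀ * v (b 0)) * t)) := by
    intro K₀
    filter_upwards [h6 K₀, hsec] with b hb hbsec
    have hPint : Integrable (fun t => P K₀ t b) μt := by
      have h1 : Integrable (fun q : ℝ × UnitAddCircle => fourier (-K₀) q.2 * (W q.1 ![q.2, b 0, b 1] : ℂ))
          (μt.prod volume) :=
        (hbsec.ofReal (𝕜 := ℂ)).bdd_mul (c := 1)
          ((fourier (-K₀)).continuous.comp continuous_snd).aestronglyMeasurable
          (Eventually.of_forall fun q => (norm_fourier_apply _ _).le)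
      exact h1.integral_prod_left
    exact ae_eq_mul_cexp_of_ae_eq_sub_mul_setIntegral hPint hb
  /- (8) swap back -/
  have h8 : ∀ᵐ t ∂μt, ∀ K₀ : ℤ, ∀ᵐ b : UnitAddTorus (Fin 2) ∂volume,
      P K₀ t b = Q K₀ b * Complex.exp (-((2 * Real.pi * Complex.I * K₀ * v (b 0)) * t)) := by
    rw [ae_all_iff]
    intro K₀
    have hmeas : MeasurableSet {q : ℝ × UnitAddTorus (Fin 2) |
        P K₀ q.1 q.2 = Q K₀ q.2 * Complex.exp (-((2 * Real.pi * Complex.I * K₀ * v (q.2 0)) * q.1))} := by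
      refine (hPsm K₀).measurableSet_eq_fun ?_
      refine ((hQsm K₀).comp_measurable measurable_snd).mul ?_
      refine Complex.continuous_exp.comp_stronglyMeasurable ?_
      refine StronglyMeasurable.neg ?_
      refine StronglyMeasurable.mul ?_ (Complex.continuous_ofReal.comp_stronglyMeasurable measurable_fst.stronglyMeasurable)
      have : StronglyMeasurable fun q : ℝ × UnitAddTorus (Fin 2) => (K₀ : ℂ) * (2 * Real.pi * Complex.I * (v (q.2 0) : ℂ)) :=
        stronglyMeasurable_const.mul (hμsm.comp_measurable measurable_snd)
      have e : (fun q : ℝ × UnitAddTorus (Fin 2) => 2 * (Real.pi : ℂ) * Complex.I * K₀ * v (q.2 0)) =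
          fun q => (K₀ : ℂ) * (2 * Real.pi * Complex.I * (v (q.2 0) : ℂ)) := funext fun q => by ring
      rw [e]
      exact this
    exact (Measure.ae_ae_comm hmeas).2 (h7 K₀)
  /- (9) identification with the skew translate, for a.e. `t` -/
  filter_upwards [h8, hWt_int, ae_restrict_mem measurableSet_Ioo] with t ht hti htI
  set S : UnitAddTorus (Fin 3) → ℝ := fun x => W₀ ![x 0 - (((t * v (x 1) : ℝ)) : UnitAddCircle), x 1, x 2] with hS
  have hc : Measurable fun z : UnitAddTorus (Fin 2) => (((t * v (z 0) : ℝ)) : UnitAddCircle) :=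
    AddCircle.measurable_mk'.comp (measurable_const.mul (hvm.measurable.comp (measurable_pi_apply 0)))
  have hS_int : Integrable S volume := by
    have h := ((measurePreserving_skewTranslate hc).integrable_comp hW₀.aestronglyMeasurable).2 hW₀
    refine h.congr (Eventually.of_forall fun x => ?_)
    simp only [hS, Function.comp_apply, Matrix.cons_val_zero]
  have hcoeff : ∀ K : Fin 3 → ℤ, mFourierCoeff (fun x => (W t x : ℂ)) K = mFourierCoeff (fun x => (S x : ℂ)) K := by
    intro K
    rw [mFourierCoeff_eq_mFourierCoeff_fibreCoeff (f := fun x => (W t x : ℂ)) hti.ofReal K,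
      mFourierCoeff_eq_mFourierCoeff_fibreCoeff (f := fun x => (S x : ℂ)) hS_int.ofReal K]
    refine mFourierCoeff_congr_ae ?_ _
    filter_upwards [ht (K 0)] with b hb
    have eS : ∀ y : UnitAddCircle, (S ![y, b 0, b 1] : ℂ) =
        (fun x : UnitAddTorus (Fin 3) => (W₀ x : ℂ)) ![y - (((t * v (b 0) : ℝ)) : UnitAddCircle), b 0, b 1] := by
      intro y
      simp only [hS, Matrix.cons_val_zero, Matrix.cons_val_one, Matrix.cons_val]
    have efour : fourier (-(K 0)) ((((t * v (b 0) : ℝ)) : UnitAddCircle)) =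
        Complex.exp (-((2 * Real.pi * Complex.I * (K 0) * v (b 0)) * t)) := by
      rw [fourier_coe_apply]
      congr 1
      push_cast
      ring
    change P (K 0) t b = ∫ y : UnitAddCircle, fourier (-(K 0)) y * (S ![y, b 0, b 1] : ℂ)
    simp_rw [eS]
    rw [fibreCoeff_skew_translate (fun x : UnitAddTorus (Fin 3) => (W₀ x : ℂ))
      (fun b : UnitAddTorus (Fin 2) => (((t * v (b 0) : ℝ)) : UnitAddCircle)) (K 0) b, efour, hb]
    simp only [hQ]
    ring
  have hae := Literature.Analysis.FunctionSpaces.Torus.ae_eq_of_forall_mFourierCoeff_eq hti.ofReal hS_int.ofReal hcoeff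
  filter_upwards [hae] with x hx
  exact_mod_cast hx

/-- The pull-back of an a.e. equality on `T` along the coordinate `x ↦ x₁` of `T³`. [folklore] -/
theorem ae_eq_comp_eval_one {f g : UnitAddCircle → ℝ} (h : f =ᵐ[volume] g) :
    (fun x : UnitAddTorus (Fin 3) => f (x 1)) =ᵐ[volume] fun x => g (x 1) :=
  measurePreserving_eval_one.quasiMeasurePreserving.ae_eq_comp h

/-- **Uniqueness for the modal shear-transport equation on `T³`** (the mechanism of
Bardos–Titi–Wiedemann 2012, Lemma 4: "the Cauchy problem for the linear transport equation
`∂ₜw + v(x₂)∂_{x₁}w = 0`, `w(·,0) = w₀` … is unique in the class `L^∞((0,T);L²)`", here in the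
modal integrated form that both the weak formulation and weak-* limits deliver). Let
`v ∈ L²(T)`, `W₀ ∈ L¹(T³)`, and let `W ∈ L^∞(0,T;L²(T³))` (jointly measurable) satisfy, for
every `K ∈ ℤ³` and a.e. `t ∈ (0,T)`,
`𝓕(W(t))(K) = 𝓕(W₀)(K) - 2πiK₀ ∫_{(0,t]} 𝓕(v(x₁)W(s))(K) ds`.
Then `W(t,x) = W₀(x₀ - t v(x₁), x₁, x₂)` for a.e. `x`, for a.e. `t ∈ (0,T)` (reduction to
strongly measurable representatives of `v`, `W₀`, `W`, and
`ae_eq_skewTranslate_of_forall_mFourierCoeff_eq_of_stronglyMeasurable`). [cite: BardosTitiWiedemann2012, Lemma 4] -/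
theorem ae_eq_skewTranslate_of_forall_mFourierCoeff_eq
    {v : UnitAddCircle → ℝ} (hv : MemLp v 2 volume)
    {W₀ : UnitAddTorus (Fin 3) → ℝ} (hW₀ : Integrable W₀ volume)
    {T : ℝ} {W : ℝ → UnitAddTorus (Fin 3) → ℝ}
    (hWm : AEStronglyMeasurable (uncurry W) ((volume.restrict (Ioo 0 T)).prod volume))
    (hWb : ∃ C : ℝ≥0, ∀ᵐ t ∂(volume.restrict (Ioo 0 T)), ∫⁻ x, ‖W t x‖ₑ ^ 2 ≤ C)
    (hmode : ∀ K : Fin 3 → ℤ, ∀ᵐ t ∂(volume.restrict (Ioo 0 T)),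
      mFourierCoeff (fun x => (W t x : ℂ)) K = mFourierCoeff (fun x => (W₀ x : ℂ)) K -
        (2 * Real.pi * Complex.I * (K 0)) *
          ∫ s in Ioc 0 t, mFourierCoeff (fun x => ((v (x 1) * W s x : ℝ) : ℂ)) K) :
    ∀ᵐ t ∂(volume.restrict (Ioo 0 T)),
      W t =ᵐ[volume] fun x => W₀ ![x 0 - (((t * v (x 1) : ℝ)) : UnitAddCircle), x 1, x 2] := by
  set μt : Measure ℝ := volume.restrict (Ioo 0 T) with hμt
  -- strongly measurable representatives
  set v' : UnitAddCircle → ℝ := hv.1.mk v with hv'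
  have hvv' : v =ᵐ[volume] v' := hv.1.ae_eq_mk
  have hv'm : StronglyMeasurable v' := hv.1.stronglyMeasurable_mk
  have hv'2 : MemLp v' 2 volume := hv.ae_eq hvv'
  set W₀' : UnitAddTorus (Fin 3) → ℝ := hW₀.1.mk W₀ with hW₀'
  have hWW₀' : W₀ =ᵐ[volume] W₀' := hW₀.1.ae_eq_mk
  have hW₀'m : StronglyMeasurable W₀' := hW₀.1.stronglyMeasurable_mk
  have hW₀'i : Integrable W₀' volume := hW₀.congr hWW₀'
  set W' : ℝ → UnitAddTorus (Fin 3) → ℝ := fun t x => hWm.mk (uncurry W) (t, x) with hW'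
  have hWW' : uncurry W =ᵐ[μt.prod volume] uncurry W' := hWm.ae_eq_mk
  have hW'sm : StronglyMeasurable (uncurry W') := hWm.stronglyMeasurable_mk
  have hslice : ∀ᵐ t ∂μt, W t =ᵐ[volume] W' t := Measure.ae_ae_eq_curry_of_prod hWW'
  have hv1 : (fun x : UnitAddTorus (Fin 3) => v (x 1)) =ᵐ[volume] fun x => v' (x 1) := ae_eq_comp_eval_one hvv'
  -- transfer of the hypotheses
  have hWb' : ∃ C : ℝ≥0, ∀ᵐ t ∂μt, ∫⁻ x, ‖W' t x‖ₑ ^ 2 ≤ C := by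
    obtain ⟨C, hC⟩ := hWb
    refine ⟨C, ?_⟩
    filter_upwards [hC, hslice] with t ht hts
    have e : ∫⁻ x, ‖W' t x‖ₑ ^ 2 = ∫⁻ x, ‖W t x‖ₑ ^ 2 :=
      lintegral_congr_ae (hts.mono fun x hx => by simp only [hx])
    rw [e]
    exact ht
  have hflux : ∀ᵐ s ∂μt, mFourierCoeff (fun x => ((v (x 1) * W s x : ℝ) : ℂ)) =
      mFourierCoeff (fun x => ((v' (x 1) * W' s x : ℝ) : ℂ)) := by
    filter_upwards [hslice] with s hs
    funext K
    refine mFourierCoeff_congr_ae ?_ K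
    filter_upwards [hs, hv1] with x hx hx1
    rw [hx, hx1]
  have hmode' : ∀ K : Fin 3 → ℤ, ∀ᵐ t ∂μt,
      mFourierCoeff (fun x => (W' t x : ℂ)) K = mFourierCoeff (fun x => (W₀' x : ℂ)) K -
        (2 * Real.pi * Complex.I * (K 0)) *
          ∫ s in Ioc 0 t, mFourierCoeff (fun x => ((v' (x 1) * W' s x : ℝ) : ℂ)) K := by
    intro K
    have hflux' : ∀ᵐ s ∂(volume : Measure ℝ), s ∈ Ioo 0 T →
        mFourierCoeff (fun x => ((v (x 1) * W s x : ℝ) : ℂ)) =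
          mFourierCoeff (fun x => ((v' (x 1) * W' s x : ℝ) : ℂ)) :=
      (ae_restrict_iff' measurableSet_Ioo).1 hflux
    filter_upwards [hmode K, hslice, ae_restrict_mem measurableSet_Ioo] with t ht hts htI
    have e1 : mFourierCoeff (fun x => (W t x : ℂ)) K = mFourierCoeff (fun x => (W' t x : ℂ)) K :=
      mFourierCoeff_congr_ae (hts.mono fun x hx => by simp only [hx]) K
    have e2 : mFourierCoeff (fun x => (W₀ x : ℂ)) K = mFourierCoeff (fun x => (W₀' x : ℂ)) K :=
      mFourierCoeff_congr_ae (hWW₀'.mono fun x hx => by simp only [hx]) K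
    rw [← e1, ← e2, ht]
    congr 1
    refine congrArg _ (setIntegral_congr_ae measurableSet_Ioc ?_)
    filter_upwards [hflux'] with s hs hsI
    rw [hs ⟨hsI.1, hsI.2.trans_lt htI.2⟩]
  have key := ae_eq_skewTranslate_of_forall_mFourierCoeff_eq_of_stronglyMeasurable hv'm hv'2 hW₀'m hW₀'i
    hW'sm hWb' hmode'
  -- transfer of the conclusion
  filter_upwards [key, hslice] with t ht hts
  have hc : Measurable fun z : UnitAddTorus (Fin 2) => (((t * v' (z 0) : ℝ)) : UnitAddCircle) :=
    AddCircle.measurable_mk'.comp (measurable_const.mul (hv'm.measurable.comp (measurable_pi_apply 0)))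
  have h1 : (fun x : UnitAddTorus (Fin 3) => W₀' ![x 0 - (((t * v' (x 1) : ℝ)) : UnitAddCircle), x 1, x 2]) =ᵐ[volume]
      fun x => W₀ ![x 0 - (((t * v' (x 1) : ℝ)) : UnitAddCircle), x 1, x 2] :=
    (measurePreserving_skewTranslate hc).quasiMeasurePreserving.ae_eq_comp hWW₀'.symm
  have h2 : (fun x : UnitAddTorus (Fin 3) => W₀ ![x 0 - (((t * v' (x 1) : ℝ)) : UnitAddCircle), x 1, x 2]) =ᵐ[volume]
      fun x => W₀ ![x 0 - (((t * v (x 1) : ℝ)) : UnitAddCircle), x 1, x 2] := by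
    filter_upwards [hv1] with x hx
    rw [hx]
  exact hts.trans (ht.trans (h1.trans h2))

end Core

end Literature.Barriers.AnomalousDissipation

end
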